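import Summits.CriticalPhenomena.CardyFormulaZ2.Theorems.CardyIKTransportIKLinearTransportWallDominationPlanarDefs
import Summits.CriticalPhenomena.CardyFormulaZ2.Theorems.CardyIKTransportIKLinearTransportThetaEnclosureChain

/-!
# `CardyIKTransport.IKLinearTransport` (stmt-CriticalPhenomena-5076), line `pinned-diagram-exchange`, lead c8 wave 3 —
# WALL DOMINATION, planar transfer: the ENCLOSURE `ThinRingObs_ring`

Support file (`--supports stmt-CriticalPhenomena-5076`, registered sub-goal `stub_thinRingObs_ring : ThinRingObs_ring` of
`…WallDominationPlanarDefs`).  A configuration in the planar chained thin-ring event `ThinRingObs a₀ b₀ s M` lies in the ring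
event `RingSeg (a₀ + s) (b₀ + M + s) s (2M + 3s)` of the core wall segment `{a₀ + s} × [b₀+M+s, b₀+M+2s)`: no white
`cellGraph`-chain meeting the segment reaches sup-distance `2M + 3s` from it.

PROOF.  Fix a white chain `p` through a cell `q` of the segment, `q = (a₀ + s, r)`, `r ∈ [b₀+M+s, b₀+M+2s)`.  The data of
`ThinRingObs` are exactly the hypotheses of the lattice Jordan lemma `thetaEnclosureChain` (`…ThetaEnclosureChain`) for the
wall column `a₀ + s`, the row `r`, the radius `2M + 3s`, the upper window rows `rowsA` (above `r`) and the lower window rows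
`rowsB` (below `r`): a black path inside the right (left) part of the band box is a right (left) link inside the sup-box of
radius `2M + 3s` around `q` (`relR_of_right`, `relL_of_left`), and the chains transfer by `Relation.ReflTransGen.mono`
(`chain_mono`).  Splitting `p = l₁ ++ q :: l₂`, both `q :: l₂` and `(l₁ ++ [q]).reverse` are white chains starting at `q`, so
every cell of `p` is within sup-distance `2M + 3s` of `q`, hence not in `farFrom (a₀ + s) (b₀ + M + s) 1 s (2M + 3s)`.
-/

noncomputable section

namespace Summit.CriticalPhenomena.CardyFormulaZ2.Theorems.IKLinearTransport.PinnedDiagramExchange.WallDomination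

open Literature.Probability.LatticeModels (Site)

namespace ThinRingObsRingStub

/-- A black path inside the RIGHT part of the band box between two wall cells is a right link of `thetaEnclosureChain`:
wall column `a₀ + s`, any core row `r ∈ [b₀+M+s, b₀+M+2s)`, radius `2M + 3s`. -/
theorem relR_of_right {x : Obs} {a₀ b₀ : ℤ} {s M : ℕ} {r : ℤ} (hr : b₀ + M + s ≤ r) (hr' : r < b₀ + M + 2 * s)
    {y y' : ℤ} (h : BlackPathIn x (rightRegion a₀ b₀ s M) (wallCell a₀ s y) (wallCell a₀ s y')) :
    ∃ γ : List (Site 2), List.IsChain (cellGraph x.2).Adj γ ∧ γ.head? = some ![a₀ + s, y] ∧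
      γ.getLast? = some ![a₀ + s, y'] ∧ ∀ v ∈ γ, v ∈ x.1 ∧ a₀ + s ≤ v 0 ∧
        |v 0 - (a₀ + s)| ≤ ((2 * M + 3 * s : ℕ) : ℤ) ∧ |v 1 - r| ≤ ((2 * M + 3 * s : ℕ) : ℤ) := by
  obtain ⟨γ, hc, hh, ht, hγ⟩ := h
  refine ⟨γ, hc, hh, ht, fun v hv => ?_⟩
  obtain ⟨hK, hv'⟩ := hγ v hv
  simp only [rightRegion, Set.mem_setOf_eq] at hv'
  exact ⟨hK, hv'.1, abs_le.2 ⟨by omega, by omega⟩, abs_le.2 ⟨by omega, by omega⟩⟩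

/-- A black path inside the LEFT part of the band box between two wall cells is a left link of `thetaEnclosureChain`:
wall column `a₀ + s`, any core row `r ∈ [b₀+M+s, b₀+M+2s)`, radius `2M + 3s`. -/
theorem relL_of_left {x : Obs} {a₀ b₀ : ℤ} {s M : ℕ} {r : ℤ} (hr : b₀ + M + s ≤ r) (hr' : r < b₀ + M + 2 * s)
    {y y' : ℤ} (h : BlackPathIn x (leftRegion a₀ b₀ s M) (wallCell a₀ s y) (wallCell a₀ s y')) :
    ∃ γ : List (Site 2), List.IsChain (cellGraph x.2).Adj γ ∧ γ.head? = some ![a₀ + s, y] ∧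
      γ.getLast? = some ![a₀ + s, y'] ∧ ∀ v ∈ γ, v ∈ x.1 ∧ v 0 ≤ a₀ + s ∧
        |v 0 - (a₀ + s)| ≤ ((2 * M + 3 * s : ℕ) : ℤ) ∧ |v 1 - r| ≤ ((2 * M + 3 * s : ℕ) : ℤ) := by
  obtain ⟨γ, hc, hh, ht, hγ⟩ := h
  refine ⟨γ, hc, hh, ht, fun v hv => ?_⟩
  obtain ⟨hK, hv'⟩ := hγ v hv
  simp only [leftRegion, Set.mem_setOf_eq] at hv'
  exact ⟨hK, hv'.2.1, abs_le.2 ⟨by omega, by omega⟩, abs_le.2 ⟨by omega, by omega⟩⟩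

/-- A chain of links of `ThinRingObs` (black paths inside the left or the right part of the band box between wall cells,
endpoints in `E`) is a chain of left/right links of `thetaEnclosureChain` (`Relation.ReflTransGen.mono`). -/
theorem chain_mono {x : Obs} {a₀ b₀ : ℤ} {s M : ℕ} {r : ℤ} (hr : b₀ + M + s ≤ r) (hr' : r < b₀ + M + 2 * s)
    (E : Set ℤ) {y₀ y₁ : ℤ}
    (h : Relation.ReflTransGen (fun y y' => y ∈ E ∧ y' ∈ E ∧
      (BlackPathIn x (leftRegion a₀ b₀ s M) (wallCell a₀ s y) (wallCell a₀ s y') ∨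
        BlackPathIn x (rightRegion a₀ b₀ s M) (wallCell a₀ s y) (wallCell a₀ s y'))) y₀ y₁) :
    Relation.ReflTransGen (fun y y' => y ∈ E ∧ y' ∈ E ∧
      ((∃ γ : List (Site 2), List.IsChain (cellGraph x.2).Adj γ ∧ γ.head? = some ![a₀ + s, y] ∧
          γ.getLast? = some ![a₀ + s, y'] ∧ ∀ v ∈ γ, v ∈ x.1 ∧ v 0 ≤ a₀ + s ∧
            |v 0 - (a₀ + s)| ≤ ((2 * M + 3 * s : ℕ) : ℤ) ∧ |v 1 - r| ≤ ((2 * M + 3 * s : ℕ) : ℤ)) ∨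
        (∃ γ : List (Site 2), List.IsChain (cellGraph x.2).Adj γ ∧ γ.head? = some ![a₀ + s, y] ∧
          γ.getLast? = some ![a₀ + s, y'] ∧ ∀ v ∈ γ, v ∈ x.1 ∧ a₀ + s ≤ v 0 ∧
            |v 0 - (a₀ + s)| ≤ ((2 * M + 3 * s : ℕ) : ℤ) ∧ |v 1 - r| ≤ ((2 * M + 3 * s : ℕ) : ℤ)))) y₀ y₁ :=
  Relation.ReflTransGen.mono (fun _ _ hy => ⟨hy.1, hy.2.1, hy.2.2.imp (relL_of_left hr hr') (relR_of_right hr hr')⟩) y₀ y₁ h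

/-- THE ENCLOSURE AT A CORE CELL: for `x ∈ ThinRingObs a₀ b₀ s M` and a white cell `q` of the core wall segment (column
`a₀ + s`, row in `[b₀+M+s, b₀+M+2s)`), every white `cellGraph`-chain starting at `q` stays within sup-distance `2M + 3s`
of `q` (`thetaEnclosureChain` with `U = rowsA`, `D = rowsB`). -/
theorem enclosure {x : Obs} {a₀ b₀ : ℤ} {s M : ℕ} (hx : x ∈ ThinRingObs a₀ b₀ s M) {r : ℤ}
    (hr : b₀ + M + s ≤ r) (hr' : r < b₀ + M + 2 * s) (hq : (![a₀ + s, r] : Site 2) ∉ x.1) :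
    ∀ π : List (Site 2), List.IsChain (cellGraph x.2).Adj π → (∀ w ∈ π, w ∉ x.1) →
      π.head? = some ![a₀ + s, r] →
        ∀ w ∈ π, |w 0 - (a₀ + s)| ≤ ((2 * M + 3 * s : ℕ) : ℤ) ∧ |w 1 - r| ≤ ((2 * M + 3 * s : ℕ) : ℤ) := by
  obtain ⟨u, hu, u', hu', d, hd, d', hd', hR, hL, hUp, hDn⟩ := hx
  have hU : ∀ y ∈ rowsA b₀ s M, r < y := fun y hy => by
    simp only [rowsA, Set.mem_setOf_eq] at hy; omega
  have hD : ∀ y ∈ rowsB b₀ s M, y < r := fun y hy => by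
    simp only [rowsB, Set.mem_setOf_eq] at hy; omega
  exact thetaEnclosureChain x.2 x.1 (a₀ + s) r (2 * M + 3 * s) (rowsA b₀ s M) (rowsB b₀ s M) hU hD u u' d d'
    hu hu' hd hd' (relR_of_right hr hr' hR) (relL_of_left hr hr' hL) (chain_mono hr hr' _ hUp)
    (chain_mono hr hr' _ hDn) hq

/-- BOTH SIDES OF A CELL OF A WHITE CHAIN: if `p` is a `cellGraph`-chain of white cells through `q`, every cell of `p` lies
on a white `cellGraph`-chain starting at `q` (the suffix from `q`, or the reversed prefix up to `q`; `cellGraph` is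
symmetric). -/
theorem mem_chain_from {A K : Set (Site 2)} {p : List (Site 2)} (hc : List.IsChain (cellGraph A).Adj p)
    (hw : ∀ w ∈ p, w ∉ K) {q v : Site 2} (hq : q ∈ p) (hv : v ∈ p) :
    ∃ π : List (Site 2), List.IsChain (cellGraph A).Adj π ∧ (∀ w ∈ π, w ∉ K) ∧ π.head? = some q ∧ v ∈ π := by
  obtain ⟨l₁, l₂, rfl⟩ := List.append_of_mem hq
  rcases List.mem_append.1 hv with h₁ | h₂
  · have hc₁ : List.IsChain (cellGraph A).Adj (l₁ ++ [q]) := by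
      have : l₁ ++ q :: l₂ = (l₁ ++ [q]) ++ l₂ := by simp
      rw [this] at hc
      exact hc.left_of_append
    refine ⟨(l₁ ++ [q]).reverse, List.isChain_reverse.2 (hc₁.imp fun _ _ h => h.symm), fun w hw' => ?_, ?_, ?_⟩
    · rw [List.mem_reverse] at hw'
      rcases List.mem_append.1 hw' with h | h
      · exact hw w (List.mem_append_left _ h)
      · rw [List.mem_singleton] at h
        subst h
        exact hw w hq
    · rw [List.reverse_append, List.reverse_singleton, List.singleton_append, List.head?_cons]
    · exact List.mem_reverse.2 (List.mem_append_left _ h₁)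
  · exact ⟨q :: l₂, hc.right_of_append, fun w hw' => hw w (List.mem_append_right _ hw'), List.head?_cons, h₂⟩

end ThinRingObsRingStub

open ThinRingObsRingStub in
/-- **Enclosure (registered sub-goal `stub_thinRingObs_ring`).**  A configuration in the planar chained thin-ring event
`ThinRingObs a₀ b₀ s M` has no white path from the core wall segment `{a₀ + s} × [b₀+M+s, b₀+M+2s)` to sup-distance
`2M + 3s`, i.e. lies in the ring event `RingSeg (a₀ + s) (b₀ + M + s) s (2M + 3s)` (lattice Jordan lemma
`thetaEnclosureChain`). -/
theorem stub_thinRingObs_ring : ThinRingObs_ring := by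
  intro a₀ b₀ s M _ x hx p hp hmeet v hv hfar
  obtain ⟨q, hq, hq0, hq0', hq1, hq1'⟩ := hmeet
  obtain ⟨-, hc, hw⟩ := hp
  have hwhite : ∀ w ∈ p, w ∉ x.1 := fun w hw' h => Bool.false_ne_true ((hw w hw').1 h)
  have hqeq : (![a₀ + s, q 1] : Site 2) = q := by
    ext i
    fin_cases i
    · simp only [Fin.zero_eta, Fin.isValue, Matrix.cons_val_zero]; omega
    · rfl
  have hr : b₀ + M + s ≤ q 1 := hq1
  have hr' : q 1 < b₀ + M + 2 * s := by omega
  obtain ⟨π, hπc, hπw, hπh, hvπ⟩ := mem_chain_from hc hwhite hq hv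
  have hbd := enclosure hx hr hr' (by rw [hqeq]; exact hwhite q hq) π hπc hπw (by rw [hπh, hqeq]) v hvπ
  have h0 := abs_le.1 hbd.1
  have h1 := abs_le.1 hbd.2
  simp only [farFrom, Set.mem_setOf_eq] at hfar
  push_cast at hfar h0 h1
  omega

end Summit.CriticalPhenomena.CardyFormulaZ2.Theorems.IKLinearTransport.PinnedDiagramExchange.WallDomination

end
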